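import Mathlib.Algebra.Group.Subgroup.Basic
import Mathlib.Algebra.Group.Subgroup.Map
import Mathlib.Algebra.Group.Subgroup.Lattice
import Mathlib.Algebra.Group.Subgroup.Pointwise
import Mathlib.Algebra.Group.Commute.Basic
import Mathlib.GroupTheory.QuotientGroup.Basic
import Mathlib.Data.ZMod.Basic
import Mathlib.Tactic.Group

/-!
# The subgroup `E_N = s(Im Π_Y) · μ_N` of an extension with abelian kernel
(group-theoretic core of [EtTh] Lemma 5.8, Lemma 5.9 (i)–(iii), Remark 5.10.3)

Source: S. Mochizuki, *The Étale Theta Function …*, Publ. RIMS 45 (2009) (`MochizukiEtTh2009`),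
§5, printed pp. 330–337 (PDF pp. 104–111 of `paper:doi-10-2977-prims-1234361159`).

In [EtTh] §5 (p. 331) one works inside the automorphism group `𝔄 = Aut_C(B_N)` of an Aut-ample
object `B_N` of the tempered Frobenioid `C`; it surjects onto `𝔊 = Aut_D(B_N^bs)` with abelian
kernel `O^×(B_N)` (cf. Remark 5.12.5 (iii): `1 → O^×(−) → Aut_C(−) → Aut_D((−)^bs) → 1`), which
contains the cyclotome `μ_N(B_N)` (the `N`-torsion of `O^×(B_N)`, [FrdII] Def. 2.1 (i)).  A
bi-Kummer root supplies a homomorphic section `s = s^⊓-gp_N : 𝔊 → 𝔄` (p. 331), and Mochizuki sets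
`E_N := s^⊓-gp_N(Im(Π^tp_Y)) · μ_N(B_N) ⊆ Aut_C(B_N)` for the subgroup `Y = Im(Π^tp_Y) ⊆ 𝔊`.

This file isolates and PROVES the purely group-theoretic content of the assertions made about
`E_N` there, for an abstract datum `(p : 𝔄 →* 𝔊, s : 𝔊 →* 𝔄, Y ≤ 𝔊, μ ≤ 𝔄)`:
* `nTorsionIn` — the `N`-torsion `μ_N` of a commutative subgroup `O ≤ 𝔄` is a subgroup, normal when
  `O` is normal (`nTorsionIn_normal`);
* `sectionSubgroup p s Y μ = Y.map s ⊔ μ` (= `E_N`) and its description as the set `s(Y) · μ`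
  (`mem_sectionSubgroup_iff`);
* Lemma 5.9 (ii): the sequence `1 → μ → E_N → Y → 1` is exact — `p` maps `E_N` onto `Y`
  (`sectionSubgroup_map_eq`) with `E_N ∩ Ker p = μ` (`sectionSubgroup_inf_ker`);
* Lemma 5.9 (i): a second section `s'` on `Y' ≤ Y` differing from `s` by a `μ`-valued cocycle
  (Prop. 4.3 (iii): "`s^⊔-gp · (s^⊓-gp)⁻¹` determines a twisted homomorphism `H_{B_N} → μ_N(B_N)`")
  takes values in `E_N` (`twisted_section_mem`);
* Lemma 5.9 (iii): `s` of the normaliser of `Y` normalises `E_N` — so `Π^tp_X ⊇ Π^tp_Y` acts on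
  `E_N` by outer automorphisms through `Π^tp_X/Π^tp_Y` (`section_normalizer_le`);
* Lemma 5.8, first step of the proof (p. 331: "the set of elements of `O^×(B_N)` that normalize the
  subgroup `E_N` is equal to the set of elements on which `Π^tp_Y` acts via multiplication by an
  element of `μ_N(B_N)`") — `kernel_mem_normalizer_iff`;
* Remark 5.10.3 (p. 337): multiplication by `M` on a cyclotome `ℤ/Nℤ` is compatible with (i.e.
  fixes) a rigidity isomorphism only if `M ≡ 1 (mod N)` — `remark_5_10_3`.
The identification of the second set in Lemma 5.8 with `(O_K^×)^{1/N}` is arithmetic (Kummer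
theory over `K`) and is NOT proved here; it is typed as a named fact in
`FrobenioidThetaEnvironment.lean`.  Mathlib-only imports.
-/

namespace Literature.AnabelianGeometry.EtaleTheta

open Subgroup

section Torsion

variable {𝔄 : Type*} [Group 𝔄]

/-- The `N`-torsion `μ_N := {u ∈ O | u^N = 1}` of a *commutative* subgroup `O` of a group `𝔄`
(for `O = O^×(A) ⊆ Aut_C(A)`, which is abelian by [FrdI] Rmk 1.3.1, this is the cyclotome
`μ_N(A)` of [FrdII] Def. 2.1 (i): "the subgroup of elements of `O^×(A)` that are annihilated by
`N`").  Commutativity is what makes it closed under multiplication.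
[cite: MochizukiEtTh2009, §5 p.331 (PDF p.105), "μ_N(B_N) ⊆ Aut_C(B_N)"] -/
def nTorsionIn (O : Subgroup 𝔄) (hO : ∀ x ∈ O, ∀ y ∈ O, x * y = y * x) (N : ℕ) : Subgroup 𝔄 where
  carrier := {u | u ∈ O ∧ u ^ N = 1}
  one_mem' := ⟨O.one_mem, one_pow N⟩
  mul_mem' := by
    rintro x y ⟨hx, hxN⟩ ⟨hy, hyN⟩
    refine ⟨O.mul_mem hx hy, ?_⟩
    have hc : Commute x y := hO x hx y hy
    rw [hc.mul_pow, hxN, hyN, one_mul]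
  inv_mem' := by
    rintro x ⟨hx, hxN⟩
    exact ⟨O.inv_mem hx, by rw [inv_pow, hxN, inv_one]⟩

/-- Membership in `μ_N`. [cite: MochizukiEtTh2009, §5 p.331 (PDF p.105)] -/
@[simp]
theorem mem_nTorsionIn {O : Subgroup 𝔄} {hO : ∀ x ∈ O, ∀ y ∈ O, x * y = y * x} {N : ℕ} {u : 𝔄} :
    u ∈ nTorsionIn O hO N ↔ u ∈ O ∧ u ^ N = 1 := Iff.rfl

/-- `μ_N ⊆ O`. [cite: MochizukiEtTh2009, §5 p.331 (PDF p.105)] -/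
theorem nTorsionIn_le (O : Subgroup 𝔄) (hO : ∀ x ∈ O, ∀ y ∈ O, x * y = y * x) (N : ℕ) :
    nTorsionIn O hO N ≤ O := fun _ h => h.1

/-- If `O` is normal in `𝔄` (e.g. `O = O^×(B_N) = Ker(Aut_C(B_N) → Aut_D(B_N^bs))` for the
Aut-ample object `B_N`, [EtTh] p. 330), then its `N`-torsion `μ_N` is normal in `𝔄` (it is
characteristic in `O`).  [cite: MochizukiEtTh2009, §5 p.330–331 (PDF pp.104–105)] -/
theorem nTorsionIn_normal (O : Subgroup 𝔄) (hO : ∀ x ∈ O, ∀ y ∈ O, x * y = y * x) (N : ℕ)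
    [hn : O.Normal] : (nTorsionIn O hO N).Normal := by
  refine ⟨fun u hu a => ?_⟩
  rcases hu with ⟨huO, huN⟩
  refine ⟨hn.conj_mem u huO a, ?_⟩
  rw [conj_pow, huN, mul_one, mul_inv_cancel]

end Torsion

section SectionSubgroup

variable {𝔄 𝔊 : Type*} [Group 𝔄] [Group 𝔊]
variable (p : 𝔄 →* 𝔊) (s : 𝔊 →* 𝔄) (Y : Subgroup 𝔊) (μ : Subgroup 𝔄)

/-- `E_N := s(Y) · μ` — in [EtTh]: `E_N := s^⊓-gp_N(Im(Π^tp_Y)) · μ_N(B_N) ⊆ Aut_C(B_N)`, for the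
homomorphic section `s^⊓-gp_N : Aut_D(B_N^bs) → Aut_C(B_N)` of a bi-Kummer root, the image
`Y = Im(Π^tp_Y) ⊆ Aut_D(B_N^bs)` and the cyclotome `μ = μ_N(B_N)`.  As a subgroup this is the join
`Y.map s ⊔ μ`; when `μ` is normal it is the set of products `s(y) · u`
(`mem_sectionSubgroup_iff`).  [cite: MochizukiEtTh2009, §5 p.331 (PDF p.105)] -/
def sectionSubgroup : Subgroup 𝔄 := Y.map s ⊔ μ

/-- `s(Y) ⊆ E_N`. [cite: MochizukiEtTh2009, §5 p.331 (PDF p.105)] -/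
theorem map_le_sectionSubgroup : Y.map s ≤ sectionSubgroup s Y μ := le_sup_left

/-- `μ ⊆ E_N` ("the natural inclusion `μ_N(B_N) ↪ E_N`", Lemma 5.9 (iv)).
[cite: MochizukiEtTh2009, Lem 5.9 (iv) p.332 (PDF p.106)] -/
theorem le_sectionSubgroup : μ ≤ sectionSubgroup s Y μ := le_sup_right

/-- `s y ∈ E_N` for `y ∈ Y`. [cite: MochizukiEtTh2009, §5 p.331 (PDF p.105)] -/
theorem section_mem_sectionSubgroup {y : 𝔊} (hy : y ∈ Y) : s y ∈ sectionSubgroup s Y μ :=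
  map_le_sectionSubgroup s Y μ ⟨y, hy, rfl⟩

/-- When `μ` is normal in `𝔄`, `E_N = Y.map s ⊔ μ` is, as a set, the product `s(Y) · μ`: every
element is `s(y) · u` with `y ∈ Y`, `u ∈ μ`.  [cite: MochizukiEtTh2009, §5 p.331 (PDF p.105)] -/
theorem mem_sectionSubgroup_iff [μ.Normal] {x : 𝔄} :
    x ∈ sectionSubgroup s Y μ ↔ ∃ y ∈ Y, ∃ u ∈ μ, x = s y * u := by
  constructor
  · intro hx
    have hx' : x ∈ ((Y.map s ⊔ μ : Subgroup 𝔄) : Set 𝔄) := hx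
    rw [Subgroup.mul_normal] at hx'
    obtain ⟨a, ha, u, hu, rfl⟩ := Set.mem_mul.mp hx'
    obtain ⟨y, hy, rfl⟩ := Subgroup.mem_map.mp ha
    exact ⟨y, hy, u, hu, rfl⟩
  · rintro ⟨y, hy, u, hu, rfl⟩
    exact (sectionSubgroup s Y μ).mul_mem (section_mem_sectionSubgroup s Y μ hy)
      (le_sectionSubgroup s Y μ hu)

/-- [EtTh] Lemma 5.9 (ii), surjectivity half of the exact sequence
`1 → μ_N(B_N) → E_N → Im(Π^tp_Y) → 1`: if `s` is a section of `p` over `Y` and `μ ⊆ Ker p`, then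
`p(E_N) = Y`.  [cite: MochizukiEtTh2009, Lem 5.9 (ii) p.332 (PDF p.106)] -/
theorem sectionSubgroup_map_eq (hs : ∀ y ∈ Y, p (s y) = y) (hμ : μ ≤ p.ker) :
    (sectionSubgroup s Y μ).map p = Y := by
  apply le_antisymm
  · rw [sectionSubgroup, Subgroup.map_sup, sup_le_iff]
    constructor
    · rintro _ ⟨_, ⟨y, hy, rfl⟩, rfl⟩
      rw [hs y hy]
      exact hy
    · rintro _ ⟨u, hu, rfl⟩
      rw [(MonoidHom.mem_ker).mp (hμ hu)]
      exact Y.one_mem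
  · intro y hy
    exact ⟨s y, section_mem_sectionSubgroup s Y μ hy, hs y hy⟩

/-- [EtTh] Lemma 5.9 (ii), exactness in the middle: `E_N ∩ Ker p = μ` — the kernel of
`E_N → Im(Π^tp_Y)` is exactly the cyclotome `μ_N(B_N)`.
[cite: MochizukiEtTh2009, Lem 5.9 (ii) p.332 (PDF p.106)] -/
theorem sectionSubgroup_inf_ker [μ.Normal] (hs : ∀ y ∈ Y, p (s y) = y) (hμ : μ ≤ p.ker) :
    sectionSubgroup s Y μ ⊓ p.ker = μ := by
  apply le_antisymm
  · rintro x ⟨hx, hxk⟩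
    obtain ⟨y, hy, u, hu, rfl⟩ := (mem_sectionSubgroup_iff s Y μ).mp hx
    have hpu : p u = 1 := (MonoidHom.mem_ker).mp (hμ hu)
    have hy1 : y = 1 := by
      have := (MonoidHom.mem_ker).mp hxk
      rwa [map_mul, hpu, mul_one, hs y hy] at this
    subst hy1
    simpa using hu
  · exact le_inf (le_sectionSubgroup s Y μ) hμ

/-- [EtTh] Lemma 5.9 (ii) packaged: `p` restricted to `E_N` has image `Y` and kernel `μ`, i.e.
`1 → μ → E_N → Y → 1` is exact.  [cite: MochizukiEtTh2009, Lem 5.9 (ii) p.332 (PDF p.106)] -/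
theorem sectionSubgroup_exact [μ.Normal] (hs : ∀ y ∈ Y, p (s y) = y) (hμ : μ ≤ p.ker) :
    (sectionSubgroup s Y μ).map p = Y ∧
      (p.comp (sectionSubgroup s Y μ).subtype).ker = μ.subgroupOf (sectionSubgroup s Y μ) := by
  refine ⟨sectionSubgroup_map_eq p s Y μ hs hμ, ?_⟩
  ext ⟨x, hx⟩
  simp only [MonoidHom.mem_ker, MonoidHom.coe_comp, Subgroup.coe_subtype, Function.comp_apply,
    Subgroup.mem_subgroupOf]
  constructor
  · intro h
    have : x ∈ sectionSubgroup s Y μ ⊓ p.ker := ⟨hx, h⟩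
    rwa [sectionSubgroup_inf_ker p s Y μ hs hμ] at this
  · intro h
    exact (MonoidHom.mem_ker).mp (hμ h)

/-- [EtTh] Lemma 5.9 (i) ("`s^⊓-gp_N|_{H_{B_N}}, s^⊔-gp_N` factor through `E_N`"), the second
section: if `s'` is defined on `Y' ⊆ Y` and differs from `s` by a `μ`-valued twisted homomorphism
— Prop. 4.3 (iii): "the difference `s^⊔-gp_N · (s^⊓-gp_N)⁻¹` determines a twisted homomorphism
`H_{B_N} → μ_N(B_N)`" — then `s'` takes values in `E_N`.  (The first section factors trivially:
`section_mem_sectionSubgroup`.)  [cite: MochizukiEtTh2009, Lem 5.9 (i) p.331 (PDF p.105)] -/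
theorem twisted_section_mem {Y' : Subgroup 𝔊} (hY' : Y' ≤ Y) (s' : Y' →* 𝔄)
    (hc : ∀ h : Y', s' h * (s h)⁻¹ ∈ μ) (h : Y') : s' h ∈ sectionSubgroup s Y μ := by
  have : s' h = (s' h * (s (h : 𝔊))⁻¹) * s (h : 𝔊) := by group
  rw [this]
  exact (sectionSubgroup s Y μ).mul_mem (le_sectionSubgroup s Y μ (hc h))
    (section_mem_sectionSubgroup s Y μ (hY' h.2))

/-- [EtTh] Lemma 5.9 (iii), well-definedness of the outer action
`l·ℤ ≅ Π^tp_X/Π^tp_Y → Out(E_N)` "determined by conjugating via the composite of the natural outer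
homomorphism `Π^tp_X ↠ Aut_D(B_N^bs)` with `s^⊓-gp_N`": if `g ∈ 𝔊` normalises `Y` (as every element
of the image of `Π^tp_X` does, `Π^tp_Y` being normal in `Π^tp_X`) and `μ` is normal in `𝔄`, then
`s g` normalises `E_N`.  [cite: MochizukiEtTh2009, Lem 5.9 (iii) p.332 (PDF p.106)] -/
theorem section_normalizer_le [μ.Normal] :
    (normalizer (Y : Set 𝔊)).map s ≤ normalizer (sectionSubgroup s Y μ : Set 𝔄) := by
  rintro _ ⟨g, hg, rfl⟩
  rw [Subgroup.mem_normalizer_iff]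
  have key : ∀ g ∈ normalizer (Y : Set 𝔊), ∀ x ∈ sectionSubgroup s Y μ,
      s g * x * (s g)⁻¹ ∈ sectionSubgroup s Y μ := by
    intro g hg x hx
    obtain ⟨y, hy, u, hu, rfl⟩ := (mem_sectionSubgroup_iff s Y μ).mp hx
    have hgy : g * y * g⁻¹ ∈ Y := (Subgroup.mem_normalizer_iff.mp hg y).mp hy
    have : s g * (s y * u) * (s g)⁻¹ = s (g * y * g⁻¹) * (s g * u * (s g)⁻¹) := by
      simp only [map_mul, map_inv]; group
    rw [this]
    exact (sectionSubgroup s Y μ).mul_mem (section_mem_sectionSubgroup s Y μ hgy)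
      (le_sectionSubgroup s Y μ (‹μ.Normal›.conj_mem u hu _))
  intro x
  constructor
  · exact key g hg x
  · intro hx
    have hg' : g⁻¹ ∈ normalizer (Y : Set 𝔊) := (normalizer (Y : Set 𝔊)).inv_mem hg
    have := key g⁻¹ hg' _ hx
    simpa [map_inv, mul_assoc] using this

/-- [EtTh] Lemma 5.8, first step of the proof: for an element `u` of the abelian kernel
`O = Ker p` (`= O^×(B_N)`), `u` normalises `E_N` if and only if "`Π^tp_Y` acts on `u` via
multiplication by an element of `μ_N(B_N)`", i.e. `s(y) u s(y)⁻¹ u⁻¹ ∈ μ` for all `y ∈ Y`.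
(The paper then identifies this set with `(O_K^×)^{1/N}` by Kummer theory over `K`; that step is
arithmetic and is not proved here.)  Hypotheses: `s` is a section of `p` over `Y`, `μ ⊆ Ker p`,
`μ` normal, `Ker p` commutative.  [cite: MochizukiEtTh2009, Lem 5.8 proof p.331 (PDF p.105)] -/
theorem kernel_mem_normalizer_iff [μ.Normal] (hs : ∀ y ∈ Y, p (s y) = y) (hμ : μ ≤ p.ker)
    (hcomm : ∀ a ∈ p.ker, ∀ b ∈ p.ker, a * b = b * a) {u : 𝔄} (hu : u ∈ p.ker) :
    u ∈ normalizer (sectionSubgroup s Y μ : Set 𝔄) ↔ ∀ y ∈ Y, s y * u * (s y)⁻¹ * u⁻¹ ∈ μ := by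
  constructor
  · intro hn y hy
    -- `u s(y) u⁻¹ ∈ E_N`, so `u s(y) u⁻¹ = s(y') v`; applying `p` gives `y' = y`.
    have h1 : u * s y * u⁻¹ ∈ sectionSubgroup s Y μ :=
      (Subgroup.mem_normalizer_iff.mp hn _).mp (section_mem_sectionSubgroup s Y μ hy)
    obtain ⟨y', hy', v, hv, heq⟩ := (mem_sectionSubgroup_iff s Y μ).mp h1
    have hpu : p u = 1 := (MonoidHom.mem_ker).mp hu
    have hpv : p v = 1 := (MonoidHom.mem_ker).mp (hμ hv)
    have hyy : y = y' := by
      have := congrArg p heq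
      simpa [map_mul, map_inv, hpu, hpv, hs y hy, hs y' hy'] using this
    subst hyy
    -- from `u s(y) u⁻¹ = s(y) v` get `s(y)⁻¹ (u s(y) u⁻¹) = v ∈ μ`, conjugate by `s(y)`, invert.
    have hv' : (s y)⁻¹ * (u * s y * u⁻¹) = v := by rw [heq]; group
    have hc : u * s y * u⁻¹ * (s y)⁻¹ ∈ μ := by
      have : s y * ((s y)⁻¹ * (u * s y * u⁻¹)) * (s y)⁻¹ ∈ μ :=
        ‹μ.Normal›.conj_mem _ (hv' ▸ hv) (s y)
      simpa [mul_assoc] using this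
    have : s y * u * (s y)⁻¹ * u⁻¹ = (u * s y * u⁻¹ * (s y)⁻¹)⁻¹ := by group
    rw [this]
    exact μ.inv_mem hc
  · intro h
    -- conjugation by `u` and by `u⁻¹` preserve `E_N`.
    have conj_mem : ∀ x ∈ sectionSubgroup s Y μ, u * x * u⁻¹ ∈ sectionSubgroup s Y μ := by
      intro x hx
      obtain ⟨y, hy, v, hv, rfl⟩ := (mem_sectionSubgroup_iff s Y μ).mp hx
      have hm : s y * u * (s y)⁻¹ * u⁻¹ ∈ μ := h y hy
      -- u (s y) u⁻¹ = m⁻¹ (s y) with m = s y u s y⁻¹ u⁻¹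
      have e1 : u * (s y * v) * u⁻¹ = (s y * u * (s y)⁻¹ * u⁻¹)⁻¹ * s y * (u * v * u⁻¹) := by
        group
      have hvk : v ∈ p.ker := hμ hv
      have e2 : u * v * u⁻¹ = v := by rw [hcomm u hu v hvk]; group
      rw [e1, e2]
      exact (sectionSubgroup s Y μ).mul_mem
        ((sectionSubgroup s Y μ).mul_mem (le_sectionSubgroup s Y μ (μ.inv_mem hm))
          (section_mem_sectionSubgroup s Y μ hy))
        (le_sectionSubgroup s Y μ hv)
    have conj_inv_mem : ∀ x ∈ sectionSubgroup s Y μ, u⁻¹ * x * u ∈ sectionSubgroup s Y μ := by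
      intro x hx
      obtain ⟨y, hy, v, hv, rfl⟩ := (mem_sectionSubgroup_iff s Y μ).mp hx
      have hm : s y * u * (s y)⁻¹ * u⁻¹ ∈ μ := h y hy
      have hmk : s y * u * (s y)⁻¹ * u⁻¹ ∈ p.ker := hμ hm
      -- u⁻¹ (s y) u = (u⁻¹ m u) (s y) where m = s y u s y⁻¹ u⁻¹, and u⁻¹ m u = m.
      have e1 : u⁻¹ * (s y * v) * u =
          (u⁻¹ * (s y * u * (s y)⁻¹ * u⁻¹) * u) * s y * (u⁻¹ * v * u) := by group
      have hvk : v ∈ p.ker := hμ hv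
      have hu' : u⁻¹ ∈ p.ker := p.ker.inv_mem hu
      have e2 : u⁻¹ * v * u = v := by
        rw [hcomm u⁻¹ hu' v hvk]; group
      have e3 : u⁻¹ * (s y * u * (s y)⁻¹ * u⁻¹) * u = s y * u * (s y)⁻¹ * u⁻¹ := by
        rw [hcomm u⁻¹ hu' _ hmk]; group
      rw [e1, e2, e3]
      exact (sectionSubgroup s Y μ).mul_mem
        ((sectionSubgroup s Y μ).mul_mem (le_sectionSubgroup s Y μ hm)
          (section_mem_sectionSubgroup s Y μ hy))
        (le_sectionSubgroup s Y μ hv)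
    rw [Subgroup.mem_normalizer_iff]
    intro x
    constructor
    · exact conj_mem x
    · intro hx
      have := conj_inv_mem _ hx
      simpa [mul_assoc] using this

end SectionSubgroup

section Remark5103

/-- [EtTh] Remark 5.10.3 (the arithmetic behind "the cyclotomic rigidity isomorphism
`(l·Δ_Θ) ⊗ (ℤ/Nℤ) ⥲ Δ[μ_N]` … is not compatible with the endomorphism of the distinct cyclotome
`Δ[μ_N]` given by multiplication by `M ∈ ℕ_{≥1}`, unless `M ≡ 1` modulo `N`"): on the cyclotome
`ℤ/Nℤ`, multiplication by `M` is the identity if and only if `M ≡ 1 (mod N)`; consequently an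
isomorphism onto a free `ℤ/Nℤ`-module of rank one composed with multiplication by `M` equals itself
only when `M ≡ 1 (mod N)`.  [cite: MochizukiEtTh2009, Rmk 5.10.3 p.337 (PDF p.111)] -/
theorem remark_5_10_3 (N M : ℕ) :
    (∀ x : ZMod N, (M : ZMod N) * x = x) ↔ M ≡ 1 [MOD N] := by
  constructor
  · intro h
    have h1 : (M : ZMod N) = ((1 : ℕ) : ZMod N) := by simpa using h 1
    exact (ZMod.natCast_eq_natCast_iff _ _ _).mp h1
  · intro h x
    have h1 : (M : ZMod N) = ((1 : ℕ) : ZMod N) := (ZMod.natCast_eq_natCast_iff _ _ _).mpr h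
    rw [h1, Nat.cast_one, one_mul]

/-- [EtTh] Remark 5.10.3, isomorphism form: if `ρ : A ≃+ ℤ/Nℤ` is an isomorphism (a "cyclotomic
rigidity isomorphism" onto the distinct cyclotome) and composing it with multiplication by `M` on
the target gives back `ρ`, then `M ≡ 1 (mod N)`.
[cite: MochizukiEtTh2009, Rmk 5.10.3 p.337 (PDF p.111)] -/
theorem remark_5_10_3_iso {A : Type*} [AddCommGroup A] (N M : ℕ) (ρ : A ≃+ ZMod N)
    (h : ∀ a : A, (M : ZMod N) * ρ a = ρ a) : M ≡ 1 [MOD N] := by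
  rw [← remark_5_10_3]
  intro x
  simpa using h (ρ.symm x)

end Remark5103

end Literature.AnabelianGeometry.EtaleTheta
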